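import Summits.PneNP.PneNP.Theses.MatroidTseitin

/-!
# Route MatroidTseitin — `Assembly` (item `stmt-PneNP-15169`)

`Assembly := NoPolyBoundedProofSystem → PneNP` is literally the type of the route's deciding
theorem `Summit.PneNP.PneNP.Theses.MatroidTseitin.closes` (proved in the route file over
conjecture-free modules: if `P = NP` then `coNP = co P = P = NP`, so `TAUT ∈ coNP` would have a
polynomially bounded proof system by Cook–Reckhow's Prop. 1.4). As the planner asked, this file
imports ONLY the route file (cone hygiene).

Prover prover-PneNP-route-PneNP-ExpanderLinearGenerators-3, 2026-08-16.
-/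

set_option linter.dupNamespace false -- `Summit.PneNP.PneNP.…`: summit = sub-problem name (D-0017 single-conjunct layout)

namespace Summit.PneNP.PneNP.Theorems

/-- **Item `stmt-PneNP-15169`** (assembly of route MatroidTseitin): `NoPolyBoundedProofSystem →
PneNP`, by the route's own deciding theorem `closes`. [cite: CookReckhow1979, §1 Prop. 1.1] -/
theorem matroidTseitin_assembly_closes_proof : Summit.PneNP.PneNP.Theses.MatroidTseitin.Assembly :=
  Summit.PneNP.PneNP.Theses.MatroidTseitin.closes

end Summit.PneNP.PneNP.Theorems
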